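import Literature.Topology.FourManifolds.CuspSplittingCoords
import Literature.Topology.FourManifolds.RankOneMapJets
import Literature.Topology.FourManifolds.SuspendedFamilyFoldChart
import HarnessLib

/-!
# The splitting chart at a critical point of a rank-one map with nondegenerate `(y₂, y₃)`-Hessian

Topic `Literature/Topology/FourManifolds` (programme of the fact
`Literature.Topology.FourManifolds.exists_isSimplifiedBrokenLefschetzFibration`, Baykur–Saeki 2017, §2.1:
the cusp of a generic map `X⁴ → Σ²` is modelled on `(t, x, y, z) ↦ (t, x³ + tx ± y² ± z²)`).
`CuspSplittingCoords.lean` split two Morse variables off a critical point of a rank-one map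
analytically; this file assembles the corresponding CHARTS:

* `HasCuspSplitChart F x` — there are centred `C^∞` charts `φ` at `x` and `ψ` at `F x` (with
  `C^∞` inverses), a `C^∞` germ `h` of two variables with `h 0 = 0` and signs `ε₂, ε₃ = ±1` with
  `ψ ∘ F = (φ₀, h(φ₀, φ₁) + ε₂ φ₂² + ε₃ φ₃²)` on the source of `φ` — the form `(†)` of
  Golubitsky–Guillemin VI §2 (p. 147) suspended by two Morse variables, i.e. the input of
  Whitney's planar cusp theorem;
* `hasCuspSplitChart_of_fibreCoords` — assembly from fibre coordinates (source chart
  `(q₀ - x₀, q₁ - x₁, Y₀, Y₁)` by the inverse function theorem, target chart a translation);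
* **`hasCuspSplitChart_rankOneMap`** — a rank-one map `y ↦ (y₀, f y)` with `df` vanishing on the
  fibre at `y₀` and nondegenerate `(y₂, y₃)`-block of `D²f_{y₀}` has a cusp-splitting chart at
  `y₀` (`exists_cuspSplittingCoords`).

Everything is proved; `HasCuspSplitChart` is the only definition; no named fact (D-0026).

## References

* M. Golubitsky, V. Guillemin, *Stable Mappings and Their Singularities*, GTM 14 (1973), Ch. VI
  §2, (†) p. 147 and proof of Thm. 2.4. [GolubitskyGuillemin1973]
* M. W. Hirsch, *Differential Topology*, GTM 33 (1976), Ch. 6 §1. [HirschDT1976]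
* R. İ. Baykur, O. Saeki, *Simplifying indefinite fibrations on 4-manifolds*, arXiv:1705.11169,
  §2.1, p. 6. [BaykurSaeki2017]
-/

noncomputable section

open Set Function Filter Module
open scoped ContDiff Topology

namespace Literature.Topology.FourManifolds

/-- Local notation: `𝔼 n` is the model Euclidean space `EuclideanSpace ℝ (Fin n)`. -/
local notation "𝔼 " n:arg => EuclideanSpace ℝ (Fin n)

/-- **Cusp-splitting chart** of `F : ℝ⁴ → ℝ²` at `x`: centred `C^∞` charts `φ` (source) and
`ψ` (target), a `C^∞` function `h` of two variables on an open `U` containing the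
`(φ₀, φ₁)`-coordinates of the source of `φ`, `h 0 = 0`, and signs `ε₂² = ε₃² = 1`, with
`ψ (F q) = (φ q₀, h(φ q₀, φ q₁) + ε₂ (φ q)₂² + ε₃ (φ q)₃²)` for `q` in the source of `φ`.
[cite: GolubitskyGuillemin1973, Ch. VI §2, (†) p. 147] -/
def HasCuspSplitChart (F : 𝔼 4 → 𝔼 2) (x : 𝔼 4) : Prop :=
  ∃ (φ : OpenPartialHomeomorph (𝔼 4) (𝔼 4)) (ψ : OpenPartialHomeomorph (𝔼 2) (𝔼 2))
    (h : ℝ × ℝ → ℝ) (U : Set (ℝ × ℝ)) (ε₂ ε₃ : ℝ),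
    x ∈ φ.source ∧ φ x = 0 ∧ MapsTo F φ.source ψ.source ∧
    ContDiffOn ℝ ∞ φ φ.source ∧ ContDiffOn ℝ ∞ φ.symm φ.target ∧
    ContDiffOn ℝ ∞ ψ ψ.source ∧ ContDiffOn ℝ ∞ ψ.symm ψ.target ∧
    IsOpen U ∧ ContDiffOn ℝ ∞ h U ∧ (∀ q ∈ φ.source, ((φ q) 0, (φ q) 1) ∈ U) ∧ h 0 = 0 ∧
    ε₂ ^ 2 = 1 ∧ ε₃ ^ 2 = 1 ∧
    ∀ q ∈ φ.source, ψ (F q) 0 = φ q 0 ∧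
      ψ (F q) 1 = h ((φ q) 0, (φ q) 1) + ε₂ * (φ q) 2 ^ 2 + ε₃ * (φ q) 3 ^ 2

/-- **Cusp-splitting chart from fibre coordinates.**  Let `F : ℝ⁴ → ℝ²`, `O` an open
neighbourhood of `x`, `Y : ℝ⁴ → ℝ²` `C^∞` on `O` with `Y x = 0` and derivative `Y'` at `x`
injective on `{v | v₀ = v₁ = 0}`, `c` `C^∞` on an open `V` containing the `(q₀, q₁)` of
`q ∈ O`, and `ε₂, ε₃ = ±1`, with `(F q)₀ = q₀` and `(F q)₁ = c(q₀, q₁) + ε₂ Y₀(q)² + ε₃ Y₁(q)²`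
on `O`.  Then `F` has a cusp-splitting chart at `x`. [folklore] -/
theorem hasCuspSplitChart_of_fibreCoords {F : 𝔼 4 → 𝔼 2} {x : 𝔼 4} {O : Set (𝔼 4)}
    (hO : IsOpen O) (hxO : x ∈ O) {Y : 𝔼 4 → 𝔼 2} (hY : ContDiffOn ℝ ∞ Y O) (hYx : Y x = 0)
    {Y' : 𝔼 4 →L[ℝ] 𝔼 2} (hYd : HasFDerivAt Y Y' x)
    (hinj : ∀ v : 𝔼 4, v 0 = 0 → v 1 = 0 → Y' v = 0 → v = 0) {V : Set (ℝ × ℝ)}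
    (hV : IsOpen V) (hOV : ∀ q ∈ O, (q 0, q 1) ∈ V) {c : ℝ × ℝ → ℝ} (hc : ContDiffOn ℝ ∞ c V)
    {ε₂ ε₃ : ℝ} (hε₂ : ε₂ ^ 2 = 1) (hε₃ : ε₃ ^ 2 = 1) (hF0 : ∀ q ∈ O, F q 0 = q 0)
    (hF1 : ∀ q ∈ O, F q 1 = c (q 0, q 1) + ε₂ * (Y q) 0 ^ 2 + ε₃ * (Y q) 1 ^ 2) :
    HasCuspSplitChart F x := by
  -- the source chart `Φ q = (q₀ - x₀, q₁ - x₁, Y₀ q, Y₁ q)`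
  set Φ : 𝔼 4 → 𝔼 4 := fun q => WithLp.toLp 2 ![q 0 - x 0, q 1 - x 1, Y q 0, Y q 1]
    with hΦ_def
  have hPc : ∀ i : Fin 4, ContDiff ℝ ∞ fun q : 𝔼 4 => q i := fun i =>
    (EuclideanSpace.proj i : 𝔼 4 →L[ℝ] ℝ).contDiff
  have hYi : ∀ i : Fin 2, ContDiffOn ℝ ∞ (fun q => Y q i) O := fun i =>
    (EuclideanSpace.proj i : 𝔼 2 →L[ℝ] ℝ).contDiff.comp_contDiffOn hY
  have hΦs : ContDiffOn ℝ ∞ Φ O := by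
    rw [contDiffOn_euclidean]
    intro i
    fin_cases i
    · simpa [hΦ_def] using ((hPc 0).sub contDiff_const).contDiffOn (s := O)
    · simpa [hΦ_def] using ((hPc 1).sub contDiff_const).contDiffOn (s := O)
    · simpa [hΦ_def] using hYi 0
    · simpa [hΦ_def] using hYi 1
  set P : Fin 4 → (𝔼 4 →L[ℝ] ℝ) := fun i => EuclideanSpace.proj i with hP_def
  have hPd : ∀ i, HasFDerivAt (fun q : 𝔼 4 => q i) (P i) x := fun i =>
    (EuclideanSpace.proj i : 𝔼 4 →L[ℝ] ℝ).hasFDerivAt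
  set Yc : Fin 2 → (𝔼 4 →L[ℝ] ℝ) := fun i => (EuclideanSpace.proj i : 𝔼 2 →L[ℝ] ℝ).comp Y'
    with hYc
  have hYcd : ∀ i : Fin 2, HasFDerivAt (fun q => Y q i) (Yc i) x := fun i =>
    (EuclideanSpace.proj i : 𝔼 2 →L[ℝ] ℝ).hasFDerivAt.comp x hYd
  set Φ' : 𝔼 4 →L[ℝ] 𝔼 4 :=
    (P 0).smulRight (EuclideanSpace.single (0 : Fin 4) (1 : ℝ)) +
      (P 1).smulRight (EuclideanSpace.single (1 : Fin 4) (1 : ℝ)) +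
      (Yc 0).smulRight (EuclideanSpace.single (2 : Fin 4) (1 : ℝ)) +
      (Yc 1).smulRight (EuclideanSpace.single (3 : Fin 4) (1 : ℝ)) with hΦ'
  have hΦd : HasFDerivAt Φ Φ' x := by
    rw [← hasFDerivWithinAt_univ]
    refine hasFDerivWithinAt_euclidean.2 fun i => ?_
    fin_cases i
    · refine (((hPd 0).sub_const (x 0)).hasFDerivWithinAt (s := univ)).congr_fderiv ?_
      ext w
      simp [hΦ', hP_def]
    · refine (((hPd 1).sub_const (x 1)).hasFDerivWithinAt (s := univ)).congr_fderiv ?_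
      ext w
      simp [hΦ', hP_def]
    · refine ((hYcd 0).hasFDerivWithinAt (s := univ)).congr_fderiv ?_
      ext w
      simp [hΦ', hP_def]
    · refine ((hYcd 1).hasFDerivWithinAt (s := univ)).congr_fderiv ?_
      ext w
      simp [hΦ', hP_def]
  have hΦ'inj : Injective Φ' := by
    refine (injective_iff_map_eq_zero Φ').2 fun w hw => ?_
    have h0 : Φ' w 0 = 0 := by rw [hw]; rfl
    have h1 : Φ' w 1 = 0 := by rw [hw]; rfl
    have h2 : Φ' w 2 = 0 := by rw [hw]; rfl
    have h3 : Φ' w 3 = 0 := by rw [hw]; rfl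
    simp [hΦ', hP_def, hYc] at h0 h1 h2 h3
    refine hinj w h0 h1 ?_
    ext i
    fin_cases i
    · simpa using h2
    · simpa using h3
  obtain ⟨T₃, hT₃⟩ := exists_continuousLinearEquiv_coe_eq hΦ'inj
  obtain ⟨G₃, hG₃Φ, hxG₃, hG₃O, hG₃s, hG₃s'⟩ :=
    exists_openPartialHomeomorph_contDiffOn_symm hO hxO (m := ∞) (by simp) hΦs T₃
      (by rw [hT₃]; exact hΦd)
  -- the target chart: translation by `-(x₀, c(x₀, x₁))`
  set w₀ : 𝔼 2 := WithLp.toLp 2 ![x 0, c (x 0, x 1)] with hw₀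
  set G₄ : OpenPartialHomeomorph (𝔼 2) (𝔼 2) := (Homeomorph.addRight (-w₀)).toOpenPartialHomeomorph
    with hG₄
  have hG₄a : (G₄ : 𝔼 2 → 𝔼 2) = fun w => w + -w₀ := by
    ext w i
    simp [hG₄]
  have hG₄sa : (G₄.symm : 𝔼 2 → 𝔼 2) = fun w => w + - -w₀ := by
    ext w i
    simp [hG₄, Homeomorph.addRight_symm]
  have hG₄src : G₄.source = univ := by simp [hG₄]
  -- the function `h` and its domain
  set h : ℝ × ℝ → ℝ := fun p => c (p.1 + x 0, p.2 + x 1) - c (x 0, x 1) with hh_def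
  set U : Set (ℝ × ℝ) := (fun p : ℝ × ℝ => (p.1 + x 0, p.2 + x 1)) ⁻¹' V with hU
  have htr : ContDiff ℝ ∞ fun p : ℝ × ℝ => (p.1 + x 0, p.2 + x 1) :=
    (contDiff_fst.add contDiff_const).prodMk (contDiff_snd.add contDiff_const)
  have hUo : IsOpen U := hV.preimage htr.continuous
  have hhs : ContDiffOn ℝ ∞ h U :=
    (hc.comp htr.contDiffOn fun p hp => hp).sub contDiffOn_const
  refine ⟨G₃, G₄, h, U, ε₂, ε₃, hxG₃, ?_, ?_, hG₃s, hG₃s', ?_, ?_, hUo, hhs, ?_, ?_, hε₂, hε₃, ?_⟩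
  · show G₃ x = 0
    rw [hG₃Φ]
    ext i
    fin_cases i <;> simp [hΦ_def, hYx]
  · intro q _
    rw [hG₄src]
    exact mem_univ _
  · rw [hG₄a]
    exact (contDiff_id.add contDiff_const).contDiffOn
  · rw [hG₄sa]
    exact (contDiff_id.add contDiff_const).contDiffOn
  · intro q hq
    have hqO : q ∈ O := hG₃O hq
    show ((fun p : ℝ × ℝ => (p.1 + x 0, p.2 + x 1)) ((G₃ q) 0, (G₃ q) 1)) ∈ V
    rw [hG₃Φ]
    simpa [hΦ_def] using hOV q hqO
  · simp [hh_def]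
  · intro q hq
    have hqO : q ∈ O := hG₃O hq
    rw [hG₃Φ, hG₄a]
    constructor
    · simp [hΦ_def, hw₀, hF0 q hqO, sub_eq_add_neg]
    · simp [hΦ_def, hw₀, hh_def, hF1 q hqO]
      ring

/-! ### The rank-one map with nondegenerate `(y₂, y₃)`-Hessian -/

/-- The two sums of squares over `Fin 2` sorted by an index `σ`. [folklore] -/
theorem neg_sum_add_sum_sq_fin_two (σ : ℕ) :
    ∃ ε₂ ε₃ : ℝ, ε₂ ^ 2 = 1 ∧ ε₃ ^ 2 = 1 ∧ ∀ a : 𝔼 2,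
      -∑ i ∈ Finset.univ.filter (fun i : Fin 2 => i.val < σ), (a i) ^ 2 +
          ∑ i ∈ Finset.univ.filter (fun i : Fin 2 => σ ≤ i.val), (a i) ^ 2 =
        ε₂ * (a 0) ^ 2 + ε₃ * (a 1) ^ 2 := by
  rcases Nat.lt_or_ge σ 1 with h0 | h1
  · -- `σ = 0`
    refine ⟨1, 1, by norm_num, by norm_num, fun a => ?_⟩
    have hA : Finset.univ.filter (fun i : Fin 2 => i.val < σ) = ∅ :=
      Finset.filter_false_of_mem fun i _ => by omega
    have hB : Finset.univ.filter (fun i : Fin 2 => σ ≤ i.val) = Finset.univ :=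
      Finset.filter_true_of_mem fun i _ => by omega
    rw [hA, hB, Finset.sum_empty, neg_zero, zero_add, Fin.sum_univ_two]
    ring
  rcases Nat.lt_or_ge σ 2 with h2 | h2
  · -- `σ = 1`
    have hσ : σ = 1 := by omega
    refine ⟨-1, 1, by norm_num, by norm_num, fun a => ?_⟩
    have hA : Finset.univ.filter (fun i : Fin 2 => i.val < σ) = {0} := by
      ext i
      fin_cases i <;> simp [hσ]
    have hB : Finset.univ.filter (fun i : Fin 2 => σ ≤ i.val) = {1} := by
      ext i
      fin_cases i <;> simp [hσ]
    rw [hA, hB, Finset.sum_singleton, Finset.sum_singleton]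
    ring
  · -- `σ ≥ 2`
    refine ⟨-1, -1, by norm_num, by norm_num, fun a => ?_⟩
    have hA : Finset.univ.filter (fun i : Fin 2 => i.val < σ) = Finset.univ :=
      Finset.filter_true_of_mem fun i _ => by have := i.isLt; omega
    have hB : Finset.univ.filter (fun i : Fin 2 => σ ≤ i.val) = ∅ :=
      Finset.filter_false_of_mem fun i _ => by have := i.isLt; omega
    rw [hA, hB, Finset.sum_empty, add_zero, Fin.sum_univ_two]
    ring

/-- **The cusp-splitting chart of a rank-one map.**  Let `f : ℝ⁴ → ℝ` be `C^∞` and `y₀` a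
point at which `df_{y₀}` vanishes on the fibre `{v | v₀ = 0}` and the `(y₂, y₃)`-block of
`D²f_{y₀}` is nondegenerate.  Then `y ↦ (y₀, f y)` has a cusp-splitting chart at `y₀`:
in centred smooth coordinates it reads `(t, x, y, z) ↦ (t, h(t, x) + ε₂ y² + ε₃ z²)`
(parametric Morse lemma over the plane, `exists_cuspSplittingCoords`).
[cite: GolubitskyGuillemin1973, Ch. VI §2, proof of Thm. 2.4] [cite: HirschDT1976, Ch. 6 §1] -/
theorem hasCuspSplitChart_rankOneMap {f : 𝔼 4 → ℝ} (hf : ContDiff ℝ ∞ f) {y₀ : 𝔼 4}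
    (hcrit : ∀ v : 𝔼 4, v 0 = 0 → fderiv ℝ f y₀ v = 0)
    (hnd : ∀ a : 𝔼 2, (∀ b : 𝔼 2, fderiv ℝ (fderiv ℝ f) y₀ (split4.symm (((0 : ℝ), (0 : ℝ)), a))
      (split4.symm (((0 : ℝ), (0 : ℝ)), b)) = 0) → a = 0) :
    HasCuspSplitChart (OneJet.rankOneMap f) y₀ := by
  obtain ⟨V, ξ, W, η, Λ, σ, hVo, hp₀V, hξ, hξ₀, -, hWo, hW₀, hWV, hηs, hη0, hηd, hid⟩ :=
    exists_cuspSplittingCoords hf hcrit hnd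
  set p₀ : ℝ × ℝ := (y₀ 0, y₀ 1) with hp₀
  have hPc : ∀ i : Fin 4, ContDiff ℝ ∞ fun q : 𝔼 4 => q i := fun i =>
    (EuclideanSpace.proj i : 𝔼 4 →L[ℝ] ℝ).contDiff
  -- the base and fibre parts of the splitting
  have hbase : ∀ q : 𝔼 4, (split4 q).1 = (q 0, q 1) := fun q => by rw [split4_apply]
  have hbc : ContDiff ℝ ∞ fun q : 𝔼 4 => ((q 0, q 1) : ℝ × ℝ) := (hPc 0).prodMk (hPc 1)
  have hfib : ContDiff ℝ ∞ fun q : 𝔼 4 => (split4 q).2 := contDiff_snd.comp split4.contDiff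
  -- `ι q = ((q₀, q₁), (q₂, q₃) - ξ(q₀, q₁))`
  set ι : 𝔼 4 → (ℝ × ℝ) × 𝔼 2 := fun q => ((q 0, q 1), (split4 q).2 - ξ (q 0, q 1)) with hι_def
  set O₁ : Set (𝔼 4) := {q | ((q 0, q 1) : ℝ × ℝ) ∈ V} with hO₁
  have hO₁o : IsOpen O₁ := hVo.preimage hbc.continuous
  have hιs : ContDiffOn ℝ ∞ ι O₁ :=
    hbc.contDiffOn.prodMk (hfib.contDiffOn.sub (hξ.comp hbc.contDiffOn fun q hq => hq))
  set O : Set (𝔼 4) := O₁ ∩ ι ⁻¹' W with hO_def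
  have hOo : IsOpen O := hιs.continuousOn.isOpen_inter_preimage hO₁o hWo
  have hy₀ι : ι y₀ = (p₀, 0) := by
    show ((y₀ 0, y₀ 1), (split4 y₀).2 - ξ (y₀ 0, y₀ 1)) = (p₀, 0)
    rw [hξ₀, sub_self]
  have hy₀O : y₀ ∈ O := ⟨hp₀V, by show ι y₀ ∈ W; rw [hy₀ι]; exact hW₀⟩
  -- fibre coordinates `Y = η ∘ ι`
  set Y : 𝔼 4 → 𝔼 2 := fun q => η (ι q) with hY_def
  have hYs : ContDiffOn ℝ ∞ Y O := hηs.comp (hιs.mono inter_subset_left) fun q hq => hq.2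
  have hYx : Y y₀ = 0 := by
    show η (ι y₀) = 0
    rw [hy₀ι]
    exact hη0 p₀ hW₀
  -- derivative of `Y` at `y₀`
  have hηD : HasFDerivAt η (fderiv ℝ η (p₀, 0)) (p₀, 0) :=
    ((hηs.contDiffAt (hWo.mem_nhds hW₀)).differentiableAt (by simp)).hasFDerivAt
  have hηΛ : (fderiv ℝ η (p₀, 0)).comp (ContinuousLinearMap.inr ℝ (ℝ × ℝ) (𝔼 2)) =
      (Λ : 𝔼 2 →L[ℝ] 𝔼 2) := by
    rw [← Literature.Analysis.Calculus.fderiv_partial_snd hηD.differentiableAt, hηd.fderiv]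
  have hξd : HasFDerivAt ξ (fderiv ℝ ξ p₀) p₀ :=
    ((hξ.contDiffAt (hVo.mem_nhds hp₀V)).differentiableAt (by simp)).hasFDerivAt
  set bL : 𝔼 4 →L[ℝ] ℝ × ℝ := (EuclideanSpace.proj (0 : Fin 4) : 𝔼 4 →L[ℝ] ℝ).prod
    (EuclideanSpace.proj (1 : Fin 4) : 𝔼 4 →L[ℝ] ℝ) with hbL
  have hbd : HasFDerivAt (fun q : 𝔼 4 => ((q 0, q 1) : ℝ × ℝ)) bL y₀ := bL.hasFDerivAt
  set fL : 𝔼 4 →L[ℝ] 𝔼 2 := (ContinuousLinearMap.snd ℝ (ℝ × ℝ) (𝔼 2)).comp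
    (split4 : 𝔼 4 →L[ℝ] (ℝ × ℝ) × 𝔼 2) with hfL
  have hfd : HasFDerivAt (fun q : 𝔼 4 => (split4 q).2) fL y₀ :=
    (ContinuousLinearMap.snd ℝ (ℝ × ℝ) (𝔼 2)).hasFDerivAt.comp y₀ split4.hasFDerivAt
  set ι' : 𝔼 4 →L[ℝ] (ℝ × ℝ) × 𝔼 2 := bL.prod (fL - (fderiv ℝ ξ p₀).comp bL) with hι'
  have hιd : HasFDerivAt ι ι' y₀ := hbd.prodMk (hfd.sub (hξd.comp y₀ hbd))
  have hηD' : HasFDerivAt η (fderiv ℝ η (p₀, 0)) (ι y₀) := by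
    rw [hy₀ι]
    exact hηD
  have hYd : HasFDerivAt Y ((fderiv ℝ η (p₀, 0)).comp ι') y₀ := hηD'.comp y₀ hιd
  have hinj : ∀ v : 𝔼 4, v 0 = 0 → v 1 = 0 → (fderiv ℝ η (p₀, 0)).comp ι' v = 0 → v = 0 := by
    intro v hv0 hv1 hv
    have hbv : bL v = 0 := Prod.ext (by simpa [hbL] using hv0) (by simpa [hbL] using hv1)
    have hι'v : ι' v = ContinuousLinearMap.inr ℝ (ℝ × ℝ) (𝔼 2) (fL v) := by
      refine Prod.ext ?_ ?_
      · simpa [hι'] using hbv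
      · simp [hι', hbv]
    rw [ContinuousLinearMap.comp_apply, hι'v, ← ContinuousLinearMap.comp_apply, hηΛ] at hv
    have hfv : fL v = 0 := Λ.injective (by rw [map_zero]; exact hv)
    have hsv : split4 v = 0 := Prod.ext (by rw [hbase]; exact hbv) (by simpa [hfL] using hfv)
    simpa using congrArg split4.symm hsv
  -- the identity on `O`
  set c : ℝ × ℝ → ℝ := fun p => f (split4.symm (p, ξ p)) with hc_def
  have hcs : ContDiffOn ℝ ∞ c V :=
    hf.comp_contDiffOn (split4.symm.contDiff.comp_contDiffOn (contDiffOn_id.prodMk hξ))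
  have hfq : ∀ q ∈ O, f q = c (q 0, q 1) -
      ∑ i ∈ Finset.univ.filter (fun i : Fin 2 => i.val < σ), (Y q i) ^ 2 +
      ∑ i ∈ Finset.univ.filter (fun i : Fin 2 => σ ≤ i.val), (Y q i) ^ 2 := by
    intro q hq
    have h := hid (ι q) hq.2
    have hq1 : (ι q).1 = (q 0, q 1) := rfl
    have hq2 : ξ (ι q).1 + (ι q).2 = (split4 q).2 := by
      show ξ (q 0, q 1) + ((split4 q).2 - ξ (q 0, q 1)) = (split4 q).2
      abel
    rw [hq2, hq1] at h
    have hq3 : split4.symm ((q 0, q 1), (split4 q).2) = q := by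
      rw [← hbase, Prod.mk.eta, ContinuousLinearEquiv.symm_apply_apply]
    rw [hq3] at h
    exact h
  obtain ⟨ε₂, ε₃, hε₂, hε₃, hsum⟩ := neg_sum_add_sum_sq_fin_two σ
  refine hasCuspSplitChart_of_fibreCoords hOo hy₀O hYs hYx hYd hinj hVo (fun q hq => hq.1) hcs
    hε₂ hε₃ (fun q _ => OneJet.rankOneMap_apply_zero f q) fun q hq => ?_
  rw [OneJet.rankOneMap_apply_one, hfq q hq]
  have h := hsum (Y q)
  linarith

end Literature.Topology.FourManifolds
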